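import Literature.RingTheory.PBasis.PBasisAdaptedToParameters
import Mathlib.RingTheory.Localization.FractionRing
import Mathlib.Algebra.CharP.Algebra
import HarnessLib

/-!
# Route `RadicialJung`, crux `CleanModels` (stmt-15917): a `p`-basis of a regular locality adapted
# to a prescribed regular system of parameters (Kimura–Niitsuma Thm. 3.4 ∘ Lemma 2.6), and transport

Support file (OURS) for PROGRAMME-clean-dim2 / T2 (`stub_lemma23`: the `p`-basis hypothesis of
`giraud_exactness` at the stalks of a regular surface over an ARBITRARY field), line
`via-clean-models` of the crux `DescentPerfectToAll` (stmt-0549). Nothing here is a statement of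
Hironaka's manuscript.

* `exists_isPBasisOver_adapted` — **for a regular locality `R = S_𝔭` over a field of
  characteristic `p` and every `x : Fin r → R` generating `𝔪` (`r = dim R`) there are a `p`-basis
  `Γ` of `R` over `R^p` and units `u_i` with `u_i x_i ∈ Γ`** — the composition of the named facts
  F-96g `KimuraNiitsuma1980_thm_3_4_proof` (a residue `p`-basis `A` with `[K : K^p(A)] = p^r`) and
  F-96f `KimuraNiitsuma1980_lemma_2_6_proof` (then `A ∪ {u_i x_i}` is a `p`-basis), both taken as
  hypotheses (CONDITIONAL on two published facts; `Literature/RingTheory/PBasis/`);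
* `IsPBasisOver.map_ringEquiv` — a `p`-basis over `R^p` is carried to a `p`-basis over `R′^p`
  by a ring isomorphism `R ≃ R′` (to move from `Localization.AtPrime` to a stalk / a subring of
  the function field).

References: T. Kimura, H. Niitsuma, J. Math. Soc. Japan 32 (1980), Lemma 2.6, Thm. 3.4
[KimuraNiitsuma1980]. 
-/

noncomputable section

set_option linter.dupNamespace false -- mandated namespace of this single-conjunct summit

open IsLocalRing Literature.RingTheory.PBasis

namespace Summit.ResolutionOfSingularities.ResolutionOfSingularities.Theorems.RadicialJung.CleanModels

universe u

/-! ## Transport of `p`-bases along ring isomorphisms -/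

section Transport

variable {p : ℕ} [Fact p.Prime] {R R' : Type u} [CommRing R] [CommRing R'] [CharP R p] [CharP R' p]

/-- A ring isomorphism maps `R^p[Γ]` into `R′^p[e Γ]`. [folklore] -/
theorem map_mem_adjoin_frobenius_image (e : R ≃+* R') (Γ : Set R) {r : R}
    (hr : r ∈ Algebra.adjoin (frobenius R p).range Γ) :
    e r ∈ Algebra.adjoin (frobenius R' p).range (e '' Γ) := by
  induction hr using Algebra.adjoin_induction with
  | mem γ hγ => exact Algebra.subset_adjoin ⟨γ, hγ, rfl⟩
  | algebraMap c =>
    obtain ⟨s, hs⟩ := c.2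
    have : e (algebraMap (frobenius R p).range R c) =
        algebraMap (frobenius R' p).range R' ⟨e s ^ p, ⟨e s, frobenius_def ..⟩⟩ := by
      change e (c : R) = e s ^ p
      rw [← hs, frobenius_def, map_pow]
    rw [this]
    exact Subalgebra.algebraMap_mem _ _
  | add a b _ _ ha hb => rw [map_add]; exact Subalgebra.add_mem _ ha hb
  | mul a b _ _ ha hb => rw [map_mul]; exact Subalgebra.mul_mem _ ha hb

/-- **A ring isomorphism carries a `p`-basis over `R^p` to a `p`-basis over `R′^p`.** [folklore] -/
theorem IsPBasisOver.map_ringEquiv (e : R ≃+* R') {Γ : Set R}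
    (h : IsPBasisOver p (frobenius R p).range Γ) :
    IsPBasisOver p (frobenius R' p).range (e '' Γ) := by
  classical
  refine ⟨?_, ?_⟩
  · rw [eq_top_iff]
    intro r' _
    have hr : e.symm r' ∈ Algebra.adjoin (frobenius R p).range Γ := by rw [h.1]; trivial
    have := map_mem_adjoin_frobenius_image e Γ hr
    rwa [RingEquiv.apply_symm_apply] at this
  · intro s b' hb' hΓ'
    -- pull the family back to `R`
    choose b hbΓ hbe using hΓ'
    have hbinj : Function.Injective b := by
      intro i j hij
      apply hb'
      rw [← hbe i, ← hbe j, hij]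
    have hli := h.2 s b hbinj hbΓ
    rw [linearIndependent_iff'] at hli ⊢
    intro t g hg n hn
    -- apply `e.symm` to the relation
    let g' : (Fin s → Fin p) → (frobenius R p).range := fun m =>
      ⟨e.symm (g m : R'), by
        obtain ⟨c, hc⟩ := (g m).2
        exact ⟨e.symm c, by rw [frobenius_def, ← map_pow, ← frobenius_def, hc]⟩⟩
    have hrel : ∑ m ∈ t, g' m • (∏ i, b i ^ ((m i : ℕ))) = 0 := by
      apply e.injective
      rw [map_sum, map_zero, ← hg]
      refine Finset.sum_congr rfl fun m _ => ?_
      rw [Subring.smul_def, Subring.smul_def, smul_eq_mul, smul_eq_mul, map_mul, map_prod]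
      simp only [g', RingEquiv.apply_symm_apply, map_pow, hbe]
    have := hli t g' hrel n hn
    apply Subtype.ext
    have h0 : e.symm (g n : R') = 0 := congrArg Subtype.val this
    simpa using congrArg e h0

end Transport

/-! ## The adapted `p`-basis of a regular locality -/

section Adapted

variable {p : ℕ} [Fact p.Prime]

/-- **A `p`-basis adapted to a prescribed regular system of parameters** (Kimura–Niitsuma 1980,
Thm. 3.4 with Lemma 2.6, both through their printed proofs): for a regular locality `R = S_𝔭` over
a field `L` of characteristic `p`, of dimension `r`, and `x : Fin r → R` generating `𝔪`, there are
a `p`-basis `Γ` of `R` over `R^p` and units `u_i` with `u_i x_i ∈ Γ` for all `i`. CONDITIONAL on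
the named facts F-96g `KimuraNiitsuma1980_thm_3_4_proof` and F-96f
`KimuraNiitsuma1980_lemma_2_6_proof`. [cite: KimuraNiitsuma1980, Thm. 3.4 and Lemma 2.6] -/
theorem exists_isPBasisOver_adapted (h34 : KimuraNiitsuma1980_thm_3_4_proof.{u})
    (h26 : KimuraNiitsuma1980_lemma_2_6_proof.{u})
    (L : Type u) [Field L] [CharP L p] (S : Type u) [CommRing S] [IsDomain S] [Algebra L S]
    [Algebra.FiniteType L S] (P : Ideal S) [P.IsPrime] [CharP (Localization.AtPrime P) p]
    [CharP (ResidueField (Localization.AtPrime P)) p]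
    (hreg : IsRegularLocalRing (Localization.AtPrime P)) (r : ℕ)
    (hdim : ringKrullDim (Localization.AtPrime P) = r)
    (x : Fin r → Localization.AtPrime P)
    (hx : Ideal.span (Set.range x) = maximalIdeal (Localization.AtPrime P)) :
    ∃ (Γ : Set (Localization.AtPrime P)) (u : Fin r → (Localization.AtPrime P)ˣ),
      IsPBasisOver p (frobenius (Localization.AtPrime P) p).range Γ ∧
        ∀ i, (u i : Localization.AtPrime P) * x i ∈ Γ := by
  obtain ⟨A, hinj, hpb, hrank⟩ := h34 p L S P hreg r hdim
  haveI : IsRegularLocalRing (Localization.AtPrime P) := hreg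
  haveI : CharP (FractionRing S) p :=
    charP_of_injective_algebraMap (IsFractionRing.injective (Localization.AtPrime P)
      (FractionRing S)) p
  obtain ⟨u, -, -, hΓ⟩ := h26 p (Localization.AtPrime P) r hdim A hinj hpb
    (FractionRing S) (hrank _) x hx
  exact ⟨_, u, hΓ, fun i => Or.inr ⟨i, rfl⟩⟩

end Adapted

end Summit.ResolutionOfSingularities.ResolutionOfSingularities.Theorems.RadicialJung.CleanModels

end
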